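import Literature.NumberTheory.EllipticCurves.Gamma0RankinSelbergResidue
import HarnessLib

/-!
# The Rankin–Selberg residue identity on `Γ₀(N)` in every weight

Topic `Literature/NumberTheory/EllipticCurves`; theorems only (no definition, no named fact). The
weight-`k` form of `Gamma0RankinSelbergResidue.lean` (which is the case `k = 2` needed for the named
fact `murty_petersson_newform_lower_bound`, `NewformPeterssonSize.lean`). For every cusp form
`f ∈ S_k(Γ₀(N))`, `k ≥ 0`, `N ≥ 1`, with Fourier coefficients `aₙ = cuspCoeff f n` and the tree's
un-normalised Petersson norm `(f, f) = peterssonProduct (Γ₀(N)) k f f`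
(`= ∫_{Γ₀(N)\\ℍ} |f|² yᵏ dx dy / y²`, `HeckeOperators.lean`):

  `lim_{s → 1⁺} (s − 1) · Σₙ |aₙ|² Γ(s+k−1) (4πn)^{-(s+k−1)} = 3 (f, f) / (π [SL₂(ℤ) : Γ₀(N)])`

(`tendsto_sub_one_mul_tsum_normSq_cuspCoeff_weight`), i.e. with `w = s + k − 1` and `k ≥ 1`:
`lim_{w→k⁺} (w − k) Σ |aₙ|² n^{-w} = 3 (4π)ᵏ (f, f) / (π Γ(k) [SL₂(ℤ):Γ₀(N)])`
(`tendsto_sub_weight_mul_tsum_normSq_cuspCoeff_div_rpow`) — Rankin's theorem (1939, for forms of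
arbitrary level) in the normalisation of Bump, *Automorphic forms and representations*, Thm. 1.6.2
(level `1`: `Res_{s=k} Λ(s, f × ḡ) = ½ π^{1−k} ⟨f, g⟩`, `Λ(s, f × g) = (2π)^{-2s}Γ(s)Γ(s−k+1)
ζ(2s−2k+2) Σ A(n)B(n) n^{-s}`; here `f = g`, the `ζ(2)Γ(k)…` bookkeeping is unwound and the index
`[SL₂(ℤ):Γ₀(N)] = gamma0Index N` appears because the Eisenstein series of the cusp `∞` of `Γ₀(N)` has
residue `3/(π [SL₂(ℤ):Γ₀(N)])`, `Gamma0EisensteinResidue.lean`).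

## Proof

Verbatim the proof of the weight-`2` file (Steps A–E of its module docstring: unfolding on the
domain `F = ⋃_q g_q⁻¹𝒟ᵒ`, the strip integral `Σ|aₙ|²Γ(a−1)(4πn)^{1−a}` with `a = s + k`, the
majorant `(s−1)G_N(τ,s) ≤ 120(5 + Im(g_q τ)²)` on the pieces, dominated convergence, and
`(f,f) = ∫_F |f|² yᵏ dμ`), with the weight `|f|² y²` replaced by `|f|² yᵏ` throughout; the only new
input is the bound `|f(z)|² yᵏ⁺² ≤ M` on `ℍ` for cusp forms of arithmetic level
(`exists_normSq_mul_im_zpow_mul_sq_le`: exponential decay for `y ≥ A` via `yᵐ ≤ m! e^{cy}/cᵐ`,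
`m = (k+2)⁺`, and Mathlib's Petersson bound `|f|² yᵏ ≤ B` for `y ≤ A`), which gives finiteness of
the piece integrals (`lintegral_piece_normSq_mul_im_zpow_smul_sq_lt_top`). The general lemmas
(`half_lt_im_of_mem_fdo`, `im_smul_le_im_add_two`, `measurable_tsum_coprime_dvd`, the unfolding,
strip, Eisenstein-residue and Eisenstein-bound files) are imported, not restated.

## References

* R. A. Rankin, *Contributions to the theory of Ramanujan's function τ(n) and similar arithmetical
  functions. II*, Proc. Cambridge Philos. Soc. 35 (1939) 357–372. [Rankin1939]
* D. Bump, *Automorphic forms and representations*, Cambridge Stud. Adv. Math. 55 (1997), §1.6,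
  Thm. 1.6.2 (read: held, PDF p. 72). [Bump1997]
* M. R. Murty, *Bounds for congruence primes*, Proc. Sympos. Pure Math. 66.1 (1999) 177–192, §2
  (the weight-2 use). [Murty1999CongruencePrimes]
-/

noncomputable section

open scoped MatrixGroups ModularForm Modular Real Topology ENNReal NNReal
open UpperHalfPlane hiding I
open MeasureTheory Set Filter Asymptotics ModularGroup ConjAct Pointwise CongruenceSubgroup
open Literature.NumberTheory.Automorphic

namespace Literature.NumberTheory.EllipticCurves.ModularForms

section PeterssonNormWeight

variable {N : ℕ} {k : ℤ} (g : (↥𝒮ℒ ⧸ (Gamma0 N : Subgroup (GL (Fin 2) ℝ)).subgroupOf 𝒮ℒ) → SL(2, ℤ))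
  (hg : ∀ q, (Matrix.SpecialLinearGroup.mapGL ℝ (g q) : GL (Fin 2) ℝ) = ((q.out : ↥𝒮ℒ) : GL (Fin 2) ℝ))

include hg in
/-- **The Petersson norm as a lower integral, weight `k`**: for `f ∈ S_k(Γ₀(N))` and a section
`g` of `SL₂(ℤ) → SL₂(ℤ)/Γ₀(N)` (`hg`), `(f, f) = ∫⁻_𝒟 Σ_q |f(g_q⁻¹τ)|² Im(g_q⁻¹τ)ᵏ dμ` (as a real
number cast to `ℂ`); the weight-`2` case is `peterssonProduct_self_eq_lintegral`. [folklore] -/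
theorem peterssonProduct_self_eq_lintegral_weight [NeZero N]
    [Fintype (↥𝒮ℒ ⧸ (Gamma0 N : Subgroup (GL (Fin 2) ℝ)).subgroupOf 𝒮ℒ)] (f : CuspForm (Gamma0 N) k) :
    peterssonProduct (Gamma0 N) k f f =
      ((∫⁻ τ in 𝒟, ∑ q, ENNReal.ofReal
        (‖f ((g q)⁻¹ • τ)‖ ^ 2 * ((g q)⁻¹ • τ).im ^ k)).toReal : ℂ) := by
  rw [peterssonProduct_eq_setIntegral]
  have hpt : ∀ q (τ : ℍ), petersson k ⇑f ⇑f (((q.out : ↥𝒮ℒ) : GL (Fin 2) ℝ)⁻¹ • τ) =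
      ((‖f ((g q)⁻¹ • τ)‖ ^ 2 * ((g q)⁻¹ • τ).im ^ k : ℝ) : ℂ) := by
    intro q τ
    have hsm : ((q.out : ↥𝒮ℒ) : GL (Fin 2) ℝ)⁻¹ • τ = (g q)⁻¹ • τ := by
      rw [← hg q, ← map_inv]; rfl
    rw [hsm, petersson_self_eq_ofReal]
  simp_rw [hpt, ← Complex.ofReal_sum]
  rw [integral_complex_ofReal]
  congr 1
  have hcont : ∀ q : (↥𝒮ℒ ⧸ (Gamma0 N : Subgroup (GL (Fin 2) ℝ)).subgroupOf 𝒮ℒ),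
      Continuous fun τ : ℍ ↦ ‖f ((g q)⁻¹ • τ)‖ ^ 2 * ((g q)⁻¹ • τ).im ^ k :=
    fun q ↦ (((ModularFormClass.continuous f).comp (continuous_sl2z_smul _)).norm.pow 2).mul
      ((continuous_im.comp (continuous_sl2z_smul _)).zpow₀ k fun τ ↦ Or.inl (im_pos _).ne')
  rw [integral_eq_lintegral_of_nonneg_ae (Eventually.of_forall fun τ ↦
      Finset.sum_nonneg fun q _ ↦ mul_nonneg (sq_nonneg _) (zpow_nonneg (im_pos _).le _))
    (continuous_finsetSum _ fun q _ ↦ hcont q).aestronglyMeasurable]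
  congr 1
  refine lintegral_congr fun τ ↦ ?_
  exact ENNReal.ofReal_sum_of_nonneg fun q _ ↦ mul_nonneg (sq_nonneg _) (zpow_nonneg (im_pos _).le _)

include hg in
/-- **Unfolding the sum over cosets, weight `k`**: `∫⁻_𝒟 Σ_q |f(g_q⁻¹τ)|² Im(g_q⁻¹τ)ᵏ dμ =
∫⁻_{⋃_q g_q⁻¹𝒟ᵒ} |f|² yᵏ dμ` (`setLIntegral_fd_sum_eq_setLIntegral_iUnion`; the weight-`2` case is
`lintegral_fd_sum_eq_lintegral_domain`). [folklore] -/
theorem lintegral_fd_sum_eq_lintegral_domain_weight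
    [Fintype (↥𝒮ℒ ⧸ (Gamma0 N : Subgroup (GL (Fin 2) ℝ)).subgroupOf 𝒮ℒ)] (f : CuspForm (Gamma0 N) k) :
    ∫⁻ τ in 𝒟, ∑ q, ENNReal.ofReal (‖f ((g q)⁻¹ • τ)‖ ^ 2 * ((g q)⁻¹ • τ).im ^ k) =
      ∫⁻ τ in ⋃ q, {τ : ℍ | g q • τ ∈ 𝒟ᵒ}, ENNReal.ofReal (‖f τ‖ ^ 2 * τ.im ^ k) :=
  setLIntegral_fd_sum_eq_setLIntegral_iUnion g hg
    (G := fun τ ↦ ENNReal.ofReal (‖f τ‖ ^ 2 * τ.im ^ k))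
    (((ModularFormClass.continuous f).norm.pow 2).mul
      (continuous_im.zpow₀ k fun _ ↦ Or.inl (im_pos _).ne')).measurable.ennreal_ofReal

end PeterssonNormWeight

section WeightBound

/-- For a cusp form `f` of arithmetic level and any weight `k`, `‖f(z)‖² (Im z)ᵏ (Im z)²` is bounded
on `ℍ`: exponential decay `‖f‖ ≤ C e^{-cy}` for `y ≥ A` (Mathlib `CuspFormClass.exp_decay_atImInfty'`)
with `yᵐ ≤ m! e^{cy}/cᵐ`, `m = (k+2)⁺`, and the Petersson bound `‖f‖² yᵏ ≤ B`
(`CuspFormClass.petersson_bounded_left`) for `y ≤ max A 1`. The weight-`2` case is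
`exists_normSq_mul_im_pow_four_le`. [folklore] -/
theorem exists_normSq_mul_im_zpow_mul_sq_le {Λ : Subgroup (GL (Fin 2) ℝ)} [Λ.IsArithmetic] {k : ℤ}
    (f : CuspForm Λ k) : ∃ M : ℝ, ∀ z : ℍ, ‖f z‖ ^ 2 * z.im ^ k * z.im ^ 2 ≤ M := by
  -- exponential decay, quantitatively
  obtain ⟨c, hc, hO⟩ := CuspFormClass.exp_decay_atImInfty' f
  obtain ⟨C, hC⟩ := hO.bound
  obtain ⟨A, hA⟩ := (UpperHalfPlane.atImInfty_mem _).mp hC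
  have hdec : ∀ τ : ℍ, A ≤ τ.im → ‖f τ‖ ≤ max C 0 * Real.exp (-c * τ.im) := by
    intro τ hτ
    have h := hA τ hτ
    simp only [mem_setOf_eq, Real.norm_eq_abs, abs_of_pos (Real.exp_pos _)] at h
    exact h.trans (mul_le_mul_of_nonneg_right (le_max_left _ _) (Real.exp_pos _).le)
  set C' : ℝ := max C 0 with hC'
  have hC'0 : 0 ≤ C' := le_max_right _ _
  -- the Petersson bound `‖f‖² yᵏ ≤ B`
  obtain ⟨B, hB⟩ := CuspFormClass.petersson_bounded_left k Λ f f
  have hB' : ∀ z : ℍ, ‖f z‖ ^ 2 * z.im ^ k ≤ B := fun z ↦ by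
    have h := hB z
    rw [petersson_self_eq_ofReal, Complex.norm_real, Real.norm_of_nonneg
      (mul_nonneg (sq_nonneg _) (zpow_nonneg z.im_pos.le _))] at h
    exact h
  have hB0 : 0 ≤ B := le_trans (mul_nonneg (sq_nonneg _) (zpow_nonneg UpperHalfPlane.I.im_pos.le _)) (hB' UpperHalfPlane.I)
  set A' : ℝ := max A 1 with hA'
  set m : ℕ := (k + 2).toNat with hm
  refine ⟨C' ^ 2 * ((Nat.factorial m : ℝ) / c ^ m) + B * A' ^ 2, fun z ↦ ?_⟩
  have hy := z.im_pos
  have hK : 0 ≤ C' ^ 2 * ((Nat.factorial m : ℝ) / c ^ m) := by positivity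
  by_cases hz : A' ≤ z.im
  · -- large imaginary part
    have hy1 : 1 ≤ z.im := (le_max_right _ _).trans hz
    have h1 : ‖f z‖ ≤ C' * Real.exp (-c * z.im) := hdec z ((le_max_left _ _).trans hz)
    have h2 : ‖f z‖ ^ 2 ≤ C' ^ 2 * Real.exp (-c * z.im) ^ 2 := by
      rw [← mul_pow]; exact pow_le_pow_left₀ (norm_nonneg _) h1 2
    -- `y^k y² ≤ y^m`
    have h3 : z.im ^ k * z.im ^ 2 ≤ z.im ^ m := by
      rw [show z.im ^ k * z.im ^ 2 = z.im ^ (k + 2) by rw [zpow_add₀ hy.ne', zpow_ofNat],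
        show z.im ^ m = z.im ^ (m : ℤ) by rw [zpow_natCast], hm]
      refine zpow_le_zpow_right₀ hy1 ?_
      exact Int.self_le_toNat (k + 2)
    -- `y^m ≤ m!/c^m e^{cy}`
    have h4 : z.im ^ m ≤ (Nat.factorial m : ℝ) / c ^ m * Real.exp (c * z.im) := by
      have h := Real.pow_div_factorial_le_exp (c * z.im) (by positivity) m
      rw [mul_pow, div_le_iff₀ (by positivity)] at h
      rw [div_mul_eq_mul_div, le_div_iff₀ (by positivity)]
      calc z.im ^ m * c ^ m = c ^ m * z.im ^ m := by ring
        _ ≤ Real.exp (c * z.im) * (Nat.factorial m) := h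
        _ = (Nat.factorial m : ℝ) * Real.exp (c * z.im) := by ring
    have h5 : Real.exp (-c * z.im) ^ 2 * ((Nat.factorial m : ℝ) / c ^ m * Real.exp (c * z.im)) ≤
        (Nat.factorial m : ℝ) / c ^ m := by
      rw [show Real.exp (-c * z.im) ^ 2 * ((Nat.factorial m : ℝ) / c ^ m * Real.exp (c * z.im)) =
        (Nat.factorial m : ℝ) / c ^ m * (Real.exp (-c * z.im) * (Real.exp (-c * z.im) * Real.exp (c * z.im))) by ring,
        ← Real.exp_add, show -c * z.im + c * z.im = 0 by ring, Real.exp_zero, mul_one]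
      have : Real.exp (-c * z.im) ≤ 1 := Real.exp_le_one_iff.mpr (by nlinarith)
      have h0 : 0 ≤ (Nat.factorial m : ℝ) / c ^ m := by positivity
      nlinarith
    calc ‖f z‖ ^ 2 * z.im ^ k * z.im ^ 2 = ‖f z‖ ^ 2 * (z.im ^ k * z.im ^ 2) := by ring
      _ ≤ (C' ^ 2 * Real.exp (-c * z.im) ^ 2) * ((Nat.factorial m : ℝ) / c ^ m * Real.exp (c * z.im)) :=
          mul_le_mul h2 (h3.trans h4) (mul_nonneg (zpow_nonneg hy.le _) (sq_nonneg _)) (by positivity)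
      _ = C' ^ 2 * (Real.exp (-c * z.im) ^ 2 * ((Nat.factorial m : ℝ) / c ^ m * Real.exp (c * z.im))) := by ring
      _ ≤ C' ^ 2 * ((Nat.factorial m : ℝ) / c ^ m) := by gcongr
      _ ≤ C' ^ 2 * ((Nat.factorial m : ℝ) / c ^ m) + B * A' ^ 2 := by nlinarith [sq_nonneg A']
  · -- small imaginary part
    push Not at hz
    have hA0 : 0 ≤ A' := zero_le_one.trans (le_max_right _ _)
    calc ‖f z‖ ^ 2 * z.im ^ k * z.im ^ 2 ≤ B * A' ^ 2 :=
          mul_le_mul (hB' z) (pow_le_pow_left₀ hy.le hz.le 2) (by positivity) hB0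
      _ ≤ C' ^ 2 * ((Nat.factorial m : ℝ) / c ^ m) + B * A' ^ 2 := by linarith

end WeightBound

section PieceIntegralWeight

variable {Γ : Subgroup (GL (Fin 2) ℝ)} [Γ.IsArithmetic] {k : ℤ}

/-- On a translate `s⁻¹𝒟ᵒ` of the open fundamental domain (`s ∈ SL(2, ℤ)`), the weight
`|f(τ)|² (Im τ)ᵏ · Im(sτ)²` of a weight-`k` cusp form of arithmetic level has finite hyperbolic
integral: substituting `z = sτ` it is `∫_{𝒟} |f∣s⁻¹|²(z) (Im z)ᵏ⁺² dμ`, and `|f∣s⁻¹|² yᵏ⁺²` is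
bounded (`exists_normSq_mul_im_zpow_mul_sq_le` for the translated cusp form
`CuspForm.translate f s⁻¹`) while `vol(𝒟) < ∞`. [folklore] -/
theorem lintegral_piece_normSq_mul_im_zpow_smul_sq_lt_top (f : CuspForm Γ k) (s : SL(2, ℤ)) :
    ∫⁻ τ in {τ : ℍ | s • τ ∈ 𝒟ᵒ}, ENNReal.ofReal (‖f τ‖ ^ 2 * τ.im ^ k * (s • τ).im ^ 2) < ∞ := by
  set G : ℍ → ℝ≥0∞ := fun τ ↦ ENNReal.ofReal (‖f τ‖ ^ 2 * τ.im ^ k * (s • τ).im ^ 2) with hG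
  have h1 : ∫⁻ τ in {τ : ℍ | s • τ ∈ 𝒟ᵒ}, G τ = ∫⁻ σ in 𝒟, G (s⁻¹ • σ) := by
    rw [← setLIntegral_setOf_smul_mem_fd_eq s G, ← setLIntegral_fd_comp_inv_smul s G]
  rw [h1]
  -- the translated cusp form
  set b : GL (Fin 2) ℝ := Matrix.SpecialLinearGroup.mapGL ℝ s with hb
  have hbmem : b ∈ 𝒮ℒ := ⟨s, rfl⟩
  haveI := isArithmetic_conj_of_mem_SL Γ (inv_mem hbmem)
  set f' := CuspForm.translate f b⁻¹ with hf'
  have hpt : ∀ σ : ℍ, G (s⁻¹ • σ) = ENNReal.ofReal (‖f' σ‖ ^ 2 * σ.im ^ k * σ.im ^ 2) := by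
    intro σ
    rw [hG]
    dsimp only
    rw [smul_inv_smul]
    congr 1
    have hp : ‖f (s⁻¹ • σ)‖ ^ 2 * (s⁻¹ • σ).im ^ k = ‖f' σ‖ ^ 2 * σ.im ^ k := by
      have h := UpperHalfPlane.petersson_slash_SL k ⇑f ⇑f s⁻¹ σ
      have hcoe : (⇑f' : ℍ → ℂ) = ⇑f ∣[(k : ℤ)] s⁻¹ := by
        rw [hf', coe_cuspForm_translate, hb, ← map_inv, ModularForm.SL_slash]
        rfl
      have h2 := congrArg (fun x : ℂ ↦ ‖x‖) h
      rw [← hcoe, petersson_self_eq_ofReal, petersson_self_eq_ofReal, Complex.norm_real, Complex.norm_real,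
        Real.norm_of_nonneg (mul_nonneg (sq_nonneg _) (zpow_nonneg (UpperHalfPlane.im_pos _).le _)),
        Real.norm_of_nonneg (mul_nonneg (sq_nonneg _) (zpow_nonneg (UpperHalfPlane.im_pos _).le _))] at h2
      exact h2.symm
    rw [hp]
  simp_rw [hpt]
  obtain ⟨M, hM⟩ := exists_normSq_mul_im_zpow_mul_sq_le f'
  calc ∫⁻ σ in 𝒟, ENNReal.ofReal (‖f' σ‖ ^ 2 * σ.im ^ k * σ.im ^ 2)
      ≤ ∫⁻ σ in 𝒟, ENNReal.ofReal M := lintegral_mono fun σ ↦ ENNReal.ofReal_le_ofReal (hM σ)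
    _ = ENNReal.ofReal M * volume 𝒟 := by rw [lintegral_const, Measure.restrict_apply_univ]
    _ < ∞ := ENNReal.mul_lt_top ENNReal.ofReal_lt_top volume_fd_lt_top

end PieceIntegralWeight


section ResidueWeight

variable {N : ℕ} [NeZero N] {k : ℤ}

omit [NeZero N] in
/-- The Petersson weight `|f(τ)|² (Im τ)ᵏ` of `f ∈ S_k(Γ₀(N))` is `Γ₀(N)`-invariant (Mathlib
`SlashInvariantFormClass.petersson_smul`). [folklore] -/
theorem normSq_mul_im_zpow_smul (f : CuspForm (Gamma0 N) k) {δ : SL(2, ℤ)} (hδ : δ ∈ Gamma0 N) (τ : ℍ) :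
    ‖f (δ • τ)‖ ^ 2 * (δ • τ).im ^ k = ‖f τ‖ ^ 2 * τ.im ^ k := by
  have hmem : (Matrix.SpecialLinearGroup.mapGL ℝ δ : GL (Fin 2) ℝ) ∈
      (Gamma0 N : Subgroup (GL (Fin 2) ℝ)) := Subgroup.mem_map_of_mem _ hδ
  have h := SlashInvariantFormClass.petersson_smul (f := f) (f' := f) (k := k) hmem (τ := τ)
  change petersson k ⇑f ⇑f (δ • τ) = petersson k ⇑f ⇑f τ at h
  have h2 := congrArg (fun x : ℂ ↦ ‖x‖) h
  rw [petersson_self_eq_ofReal, petersson_self_eq_ofReal, Complex.norm_real, Complex.norm_real,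
    Real.norm_of_nonneg (mul_nonneg (sq_nonneg _) (zpow_nonneg (UpperHalfPlane.im_pos _).le _)),
    Real.norm_of_nonneg (mul_nonneg (sq_nonneg _) (zpow_nonneg (UpperHalfPlane.im_pos _).le _))] at h2
  exact h2

/-- **The Rankin–Selberg residue identity for the Petersson norm on `Γ₀(N)`, weight `k ≥ 0`.** For
every cusp form `f ∈ S_k(Γ₀(N))`, `N ≥ 1`, with `aₙ = cuspCoeff f n` and the tree's un-normalised
Petersson norm `(f, f) = peterssonProduct (Γ₀(N)) k f f` (`= ∫_{Γ₀(N)\\ℍ}|f|² yᵏ dμ`):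
`(s − 1) · Σₙ |aₙ|² Γ(s+k−1) (4πn)^{-(s+k−1)} → 3 Re(f, f) / (π · gamma0Index N)` as `s → 1⁺`
(`gamma0Index N = [SL₂(ℤ):Γ₀(N)]`): Rankin–Selberg unfolding against the Eisenstein series of the
cusp `∞` of `Γ₀(N)`, the strip integral with exponent `a = s + k`, the residue
`3/(π[SL₂(ℤ):Γ₀(N)])` of that Eisenstein series and dominated convergence — the proof of the
weight-`2` theorem `tendsto_sub_one_mul_tsum_normSq_cuspCoeff` with `y²` replaced by `yᵏ`.
(Rankin 1939 for arbitrary level; Bump Thm. 1.6.2 for level `1`.)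
[cite: Bump1997, Thm. 1.6.2 (Res_{s=k} Λ(s,f×ḡ) = ½π^{1−k}⟨f,g⟩, level 1); Rankin1939 (Stufe N)] -/
theorem tendsto_sub_one_mul_tsum_normSq_cuspCoeff_weight (hk : 0 ≤ k) (f : CuspForm (Gamma0 N) k) :
    Tendsto (fun s : ℝ ↦ (s - 1) * ∑' n : ℕ, ‖cuspCoeff f n‖ ^ 2 *
        ((1 / (4 * π * n)) ^ (s + k - 1) * Real.Gamma (s + k - 1)))
      (𝓝[>] 1) (𝓝 (3 * (peterssonProduct (Gamma0 N) k f f).re / (π * gamma0Index N))) := by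
  classical
  obtain ⟨g, hg⟩ := exists_mapGL_eq_out (N := N)
  letI : Fintype (↥𝒮ℒ ⧸ (Gamma0 N : Subgroup (GL (Fin 2) ℝ)).subgroupOf 𝒮ℒ) := Fintype.ofFinite _
  have hN : 0 < N := NeZero.pos N
  have hΓ : (1 : ℝ) ∈ (Gamma0 N : Subgroup (GL (Fin 2) ℝ)).strictPeriods :=
    strictWidthInfty_Gamma0 N ▸ Subgroup.strictWidthInfty_mem_strictPeriods _
  -- notation (`F` kept opaque, with its defining equation `hFdef`)
  obtain ⟨F, hFdef⟩ : ∃ F : Set ℍ, F = ⋃ q, {τ : ℍ | g q • τ ∈ 𝒟ᵒ} := ⟨_, rfl⟩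
  have hF : MeasurableSet F := by rw [hFdef]; exact measurableSet_domain g
  set Φr : ℍ → ℝ := fun τ ↦ ‖f τ‖ ^ 2 * τ.im ^ k with hΦr
  have hΦr_nonneg : ∀ τ, 0 ≤ Φr τ := fun τ ↦ by
    rw [hΦr]; exact mul_nonneg (sq_nonneg _) (zpow_nonneg τ.im_pos.le _)
  have hΦr_cont : Continuous Φr :=
    ((ModularFormClass.continuous f).norm.pow 2).mul (continuous_im.zpow₀ k fun τ ↦ Or.inl τ.im_pos.ne')
  set GN : ℍ → ℝ → ℝ := fun τ s ↦ ∑' v : {v : Fin 2 → ℤ // IsCoprime (v 0) (v 1) ∧ (N : ℤ) ∣ v 0},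
    (τ.im / Complex.normSq ((v.1 0 : ℂ) * τ + v.1 1)) ^ s with hGN
  set G1 : ℍ → ℝ → ℝ := fun τ s ↦ ∑' v : {v : Fin 2 → ℤ // IsCoprime (v 0) (v 1) ∧ ((1 : ℕ) : ℤ) ∣ v 0},
    (τ.im / Complex.normSq ((v.1 0 : ℂ) * τ + v.1 1)) ^ s with hG1
  have hq : ∀ (τ : ℍ) (p : Fin 2 → ℤ), 0 ≤ τ.im / Complex.normSq ((p 0 : ℂ) * τ + p 1) := fun τ p ↦
    div_nonneg τ.im_pos.le (Complex.normSq_nonneg _)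
  have hGN_nonneg : ∀ τ s, 0 ≤ GN τ s := fun τ s ↦ tsum_nonneg fun v ↦ Real.rpow_nonneg (hq τ _) _
  have hkr : (0 : ℝ) ≤ k := by exact_mod_cast hk
  set c : ℕ → ℝ → ℝ := fun n s ↦ ‖cuspCoeff f n‖ ^ 2 * ((1 / (4 * π * n)) ^ (s + k - 1) * Real.Gamma (s + k - 1))
    with hc
  have hc_nonneg : ∀ n : ℕ, ∀ s : ℝ, 1 < s → 0 ≤ c n s := fun n s hs ↦ by
    rw [hc]
    dsimp only
    have : 0 < Real.Gamma (s + k - 1) := Real.Gamma_pos_of_pos (by linarith)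
    positivity
  -- ### Step A: the unfolded identity in `ℝ≥0∞`
  have hΦinv : ∀ δ ∈ Gamma0 N, ∀ τ : ℍ, ENNReal.ofReal (Φr (δ • τ)) = ENNReal.ofReal (Φr τ) := by
    intro δ hδ τ
    rw [hΦr]
    dsimp only
    rw [normSq_mul_im_zpow_smul f hδ τ]
  have hΦm : Measurable fun τ ↦ ENNReal.ofReal (Φr τ) := hΦr_cont.measurable.ennreal_ofReal
  have stepA : ∀ s : ℝ, 1 < s →
      ∫⁻ τ in F, ENNReal.ofReal (Φr τ) * ENNReal.ofReal (GN τ s) =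
        2 * ∑' n : ℕ, ENNReal.ofReal (c n s) := by
    intro s hs
    have hU := lintegral_domain_mul_eisenstein_eq g hg (fun τ ↦ ENNReal.ofReal (Φr τ)) hΦm hΦinv
      (fun y ↦ ENNReal.ofReal (y ^ s)) ((measurable_id.pow_const s).ennreal_ofReal)
    -- the inner sum is `ofReal (GN τ s)`
    have hinner : ∀ τ : ℍ, ∑' v : {v : Fin 2 → ℤ // IsCoprime (v 0) (v 1) ∧ (N : ℤ) ∣ v 0},
        ENNReal.ofReal ((τ.im / Complex.normSq ((v.1 0 : ℂ) * τ + v.1 1)) ^ s) = ENNReal.ofReal (GN τ s) := by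
      intro τ
      rw [hGN]
      exact (ENNReal.ofReal_tsum_of_nonneg (fun v ↦ Real.rpow_nonneg (hq τ _) _)
        ((summable_rpow_im_div_normSq τ hs).comp_injective Subtype.val_injective)).symm
    simp_rw [hinner] at hU
    rw [← hFdef] at hU
    rw [hU]
    -- the strip integral
    have hstrip : ∫⁻ ρ in {ρ : ℍ | 0 ≤ ρ.re ∧ ρ.re < 1}, ENNReal.ofReal (Φr ρ) * ENNReal.ofReal (ρ.im ^ s) =
        ∫⁻ ρ in {ρ : ℍ | 0 ≤ ρ.re ∧ ρ.re < 1}, ENNReal.ofReal (‖f ρ‖ ^ 2 * ρ.im ^ (s + k)) := by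
      refine lintegral_congr fun ρ ↦ ?_
      rw [hΦr]
      dsimp only
      rw [← ENNReal.ofReal_mul (mul_nonneg (sq_nonneg _) (zpow_nonneg ρ.im_pos.le _))]
      congr 1
      rw [Real.rpow_add_intCast ρ.im_pos.ne' s k]
      ring
    rw [hstrip, lintegral_strip_normSq_mul_rpow hΓ f (a := s + k) (by linarith)]
  -- ### Step B: the majorant `(s − 1) G_N(τ, s) ≤ B τ` on `F` for `1 < s ≤ 2`
  set B : ℍ → ℝ := fun τ ↦ 60 * ∑ q, (1 + (g q • τ).im ^ 2) with hB
  have hB_nonneg : ∀ τ, 0 ≤ B τ := fun τ ↦ by rw [hB]; positivity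
  have hB_cont : Continuous B := by
    rw [hB]
    refine continuous_const.mul (continuous_finsetSum _ fun q _ ↦ ?_)
    exact continuous_const.add ((continuous_im.comp (continuous_sl2z_smul _)).pow 2)
  have hmaj : ∀ s : ℝ, 1 < s → s ≤ 2 → ∀ τ ∈ F, (s - 1) * GN τ s ≤ B τ := by
    intro s hs1 hs2 τ hτ
    rw [hFdef, mem_iUnion] at hτ
    obtain ⟨q₀, hq₀⟩ := hτ
    have hhalf : 1 / 2 ≤ (g q₀ • τ).im := (half_lt_im_of_mem_fdo hq₀).le
    have h1 : GN τ s ≤ G1 τ s := tsum_coprime_dvd_le_tsum_coprime τ hs1 N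
    have h2 : G1 τ s = G1 (g q₀ • τ) s := (tsum_coprime_smul (g q₀) τ s).symm
    have h3 : (s - 1) * G1 (g q₀ • τ) s ≤ 60 * (1 + (g q₀ • τ).im ^ 2) :=
      sub_one_mul_tsum_coprime_le _ hhalf hs1 hs2
    have h4 : 60 * (1 + (g q₀ • τ).im ^ 2) ≤ B τ := by
      rw [hB]
      dsimp only
      refine mul_le_mul_of_nonneg_left ?_ (by norm_num)
      exact Finset.single_le_sum (f := fun q ↦ 1 + (g q • τ).im ^ 2) (fun q _ ↦ by positivity)
        (Finset.mem_univ q₀)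
    have hs0 : 0 ≤ s - 1 := by linarith
    calc (s - 1) * GN τ s ≤ (s - 1) * G1 τ s := mul_le_mul_of_nonneg_left h1 hs0
      _ = (s - 1) * G1 (g q₀ • τ) s := by rw [h2]
      _ ≤ 60 * (1 + (g q₀ • τ).im ^ 2) := h3
      _ ≤ B τ := h4
  -- ### Step C: integrability of the majorant `Φr · B` on `F`
  have hpiece_sub : ∀ q, {τ : ℍ | g q • τ ∈ 𝒟ᵒ} ⊆ F := fun q ↦ by
    rw [hFdef]; exact subset_iUnion (fun q ↦ {τ : ℍ | g q • τ ∈ 𝒟ᵒ}) q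
  have hΦ_lt_top : ∫⁻ τ in F, ENNReal.ofReal (Φr τ) < ∞ := by
    -- `∫⁻_F |f|² y² = ∫⁻_𝒟 Σ_q |f|²y²(g_q⁻¹ ·)`, each summand integrable
    have h := lintegral_fd_sum_eq_lintegral_domain_weight g hg f
    rw [hΦr]
    change ∫⁻ τ in F, ENNReal.ofReal (‖f τ‖ ^ 2 * τ.im ^ k) < ∞
    rw [hFdef, ← h]
    have hterm : ∀ q, ∫⁻ τ in 𝒟, ENNReal.ofReal (‖f ((g q)⁻¹ • τ)‖ ^ 2 * ((g q)⁻¹ • τ).im ^ k) < ∞ := by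
      intro q
      have hint := integrableOn_petersson_comp_smul_fd k f f
        (b := (Matrix.SpecialLinearGroup.mapGL ℝ (g q) : GL (Fin 2) ℝ)) ⟨g q, rfl⟩
      have hint' : IntegrableOn (fun τ : ℍ ↦ ‖f ((g q)⁻¹ • τ)‖ ^ 2 * ((g q)⁻¹ • τ).im ^ k) 𝒟 := by
        refine IntegrableOn.congr_fun hint.norm (fun τ _ ↦ ?_) isClosed_fd.measurableSet
        change ‖petersson k ⇑f ⇑f ((Matrix.SpecialLinearGroup.mapGL ℝ (g q) : GL (Fin 2) ℝ)⁻¹ • τ)‖ = _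
        rw [← map_inv]
        change ‖petersson k ⇑f ⇑f ((g q)⁻¹ • τ)‖ = _
        rw [petersson_self_eq_ofReal, Complex.norm_real,
          Real.norm_of_nonneg (mul_nonneg (sq_nonneg _) (zpow_nonneg (UpperHalfPlane.im_pos _).le _))]
      exact hint'.setLIntegral_lt_top
    rw [lintegral_finsetSum' _ fun q _ ↦ ?_]
    · exact ENNReal.sum_lt_top.mpr fun q _ ↦ hterm q
    · exact ((((ModularFormClass.continuous f).comp (continuous_sl2z_smul _)).norm.pow 2).mul
        ((continuous_im.comp (continuous_sl2z_smul _)).zpow₀ k fun τ ↦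
          Or.inl (UpperHalfPlane.im_pos _).ne')).measurable.ennreal_ofReal.aemeasurable
  have hbound_lt_top : ∫⁻ τ in F, ENNReal.ofReal (Φr τ * B τ) < ∞ := by
    -- `Φr · B = 60 Σ_q (Φr + Φr · Im(g_q τ)²)`
    have hsplit : ∀ τ, ENNReal.ofReal (Φr τ * B τ) =
        60 * ∑ q, (ENNReal.ofReal (Φr τ) + ENNReal.ofReal (Φr τ * (g q • τ).im ^ 2)) := by
      intro τ
      have e1 : Φr τ * B τ = 60 * ∑ q, (Φr τ + Φr τ * (g q • τ).im ^ 2) := by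
        rw [hB]
        dsimp only
        rw [Finset.mul_sum, Finset.mul_sum, Finset.mul_sum]
        refine Finset.sum_congr rfl fun q _ ↦ ?_
        ring
      rw [e1, ENNReal.ofReal_mul (by norm_num), ENNReal.ofReal_sum_of_nonneg (fun q _ ↦ by positivity)]
      have e60 : ENNReal.ofReal 60 = 60 := by norm_num
      rw [e60]
      congr 1
      refine Finset.sum_congr rfl fun q _ ↦ ?_
      rw [ENNReal.ofReal_add (hΦr_nonneg τ) (by positivity)]
    simp_rw [hsplit]
    have hmeas_q : ∀ q, Measurable fun τ ↦ ENNReal.ofReal (Φr τ) + ENNReal.ofReal (Φr τ * (g q • τ).im ^ 2) :=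
      fun q ↦ hΦm.add (hΦr_cont.mul ((continuous_im.comp (continuous_sl2z_smul _)).pow 2)).measurable.ennreal_ofReal
    rw [lintegral_const_mul _ (Finset.measurable_sum _ fun q _ ↦ hmeas_q q),
      lintegral_finsetSum' _ fun q _ ↦ (hmeas_q q).aemeasurable]
    refine ENNReal.mul_lt_top (by norm_num) (ENNReal.sum_lt_top.mpr fun q _ ↦ ?_)
    rw [lintegral_add_left hΦm]
    refine ENNReal.add_lt_top.mpr ⟨hΦ_lt_top, ?_⟩
    -- `∫⁻_F Φr · Im(g_q τ)² ≤ Σ_{q₀} ∫⁻_{piece q₀} ...`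
    rw [hFdef]
    refine lt_of_le_of_lt (lintegral_iUnion_le _ _) ?_
    rw [tsum_fintype]
    refine ENNReal.sum_lt_top.mpr fun q₀ _ ↦ ?_
    -- on the piece `q₀`: `Im(g_q τ)² ≤ 2 Im(g_{q₀} τ)² + 8`
    have hmeasP : Measurable fun τ : ℍ ↦ ENNReal.ofReal (‖f τ‖ ^ 2 * τ.im ^ k * (g q₀ • τ).im ^ 2) :=
      ((((ModularFormClass.continuous f).norm.pow 2).mul (continuous_im.zpow₀ k fun τ ↦ Or.inl τ.im_pos.ne')).mul
        ((continuous_im.comp (continuous_sl2z_smul _)).pow 2)).measurable.ennreal_ofReal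
    have hle : ∫⁻ τ in {τ : ℍ | g q₀ • τ ∈ 𝒟ᵒ}, ENNReal.ofReal (Φr τ * (g q • τ).im ^ 2) ≤
        ∫⁻ τ in {τ : ℍ | g q₀ • τ ∈ 𝒟ᵒ}, (2 * ENNReal.ofReal (‖f τ‖ ^ 2 * τ.im ^ k * (g q₀ • τ).im ^ 2) +
          8 * ENNReal.ofReal (Φr τ)) := by
      refine setLIntegral_mono' (isOpen_setOf_smul_mem_fdo (g q₀)).measurableSet fun τ hτ ↦ ?_
      have hhalf : 1 / 2 ≤ (g q₀ • τ).im := (half_lt_im_of_mem_fdo hτ).le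
      have him : (g q • τ).im ≤ (g q₀ • τ).im + 2 := by
        have := im_smul_le_im_add_two (g q * (g q₀)⁻¹) hhalf
        rwa [mul_smul, inv_smul_smul] at this
      have him0 : 0 ≤ (g q • τ).im := ((g q • τ).im_pos).le
      have hsq : (g q • τ).im ^ 2 ≤ 2 * (g q₀ • τ).im ^ 2 + 8 := by
        have h1 : (g q • τ).im ^ 2 ≤ ((g q₀ • τ).im + 2) ^ 2 := pow_le_pow_left₀ him0 him 2
        nlinarith [h1, sq_nonneg ((g q₀ • τ).im - 2)]
      rw [hΦr]
      dsimp only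
      have e2 : (2 : ℝ≥0∞) = ENNReal.ofReal 2 := by norm_num
      have e8 : (8 : ℝ≥0∞) = ENNReal.ofReal 8 := by norm_num
      have hP0 : 0 ≤ ‖f τ‖ ^ 2 * τ.im ^ k := mul_nonneg (sq_nonneg _) (zpow_nonneg τ.im_pos.le _)
      rw [e2, e8, ← ENNReal.ofReal_mul (by norm_num), ← ENNReal.ofReal_mul (by norm_num),
        ← ENNReal.ofReal_add (by positivity) (by positivity)]
      refine ENNReal.ofReal_le_ofReal ?_
      have hP : 0 ≤ ‖f τ‖ ^ 2 * τ.im ^ k := mul_nonneg (sq_nonneg _) (zpow_nonneg τ.im_pos.le _)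
      nlinarith
    refine lt_of_le_of_lt hle ?_
    rw [lintegral_add_left (hmeasP.const_mul 2), lintegral_const_mul _ hmeasP, lintegral_const_mul _ hΦm]
    refine ENNReal.add_lt_top.mpr ⟨ENNReal.mul_lt_top (by norm_num)
      (lintegral_piece_normSq_mul_im_zpow_smul_sq_lt_top f (g q₀)), ENNReal.mul_lt_top (by norm_num) ?_⟩
    exact lt_of_le_of_lt (lintegral_mono_set (hpiece_sub q₀)) hΦ_lt_top
  -- ### Step D: dominated convergence on `F`
  set h : ℝ → ℍ → ℝ := fun s τ ↦ Φr τ * ((s - 1) * GN τ s) with hh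
  have hGN_meas : ∀ s : ℝ, 1 < s → Measurable fun τ ↦ GN τ s := fun s hs ↦ by
    rw [hGN]; exact measurable_tsum_coprime_dvd hs N
  have hh_meas : ∀ s : ℝ, 1 < s → AEStronglyMeasurable (h s) (volume.restrict F) := fun s hs ↦
    (hΦr_cont.measurable.mul ((hGN_meas s hs).const_mul _)).aestronglyMeasurable
  have hD1 : ∀ᶠ s in 𝓝[>] (1 : ℝ), AEStronglyMeasurable (h s) (volume.restrict F) := by
    filter_upwards [self_mem_nhdsWithin] with s hs using hh_meas s hs
  have hD2 : ∀ᶠ s in 𝓝[>] (1 : ℝ), ∀ᵐ τ ∂(volume.restrict F), ‖h s τ‖ ≤ Φr τ * B τ := by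
    filter_upwards [Ioc_mem_nhdsGT (show (1 : ℝ) < 2 by norm_num)] with s hs
    filter_upwards [ae_restrict_mem hF] with τ hτ
    rw [hh]
    dsimp only
    rw [Real.norm_eq_abs, abs_of_nonneg (mul_nonneg (hΦr_nonneg τ) (mul_nonneg (by linarith [hs.1]) (hGN_nonneg τ s)))]
    exact mul_le_mul_of_nonneg_left (hmaj s hs.1 hs.2 τ hτ) (hΦr_nonneg τ)
  have hD3 : Integrable (fun τ ↦ Φr τ * B τ) (volume.restrict F) := by
    refine ⟨(hΦr_cont.mul hB_cont).aestronglyMeasurable, ?_⟩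
    rw [hasFiniteIntegral_iff_ofReal (ae_of_all _ fun τ ↦ mul_nonneg (hΦr_nonneg τ) (hB_nonneg τ))]
    exact hbound_lt_top
  have hD4 : ∀ᵐ τ ∂(volume.restrict F), Tendsto (fun s ↦ h s τ) (𝓝[>] 1) (𝓝 (Φr τ * (6 / (π * gamma0Index N)))) :=
    ae_of_all _ fun τ ↦ ((tendsto_sub_one_mul_tsum_coprime_dvd τ hN).const_mul (Φr τ))
  have hDCT := tendsto_integral_filter_of_dominated_convergence (fun τ ↦ Φr τ * B τ) hD1 hD2 hD3 hD4
  -- ### Step E: identify both sides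
  have hPet : (peterssonProduct (Gamma0 N) k f f).re = (∫⁻ τ in F, ENNReal.ofReal (Φr τ)).toReal := by
    rw [peterssonProduct_self_eq_lintegral_weight g hg f, Complex.ofReal_re, lintegral_fd_sum_eq_lintegral_domain_weight g hg f,
      hFdef]
  have hlimval : ∫ τ in F, Φr τ * (6 / (π * gamma0Index N)) =
      (6 / (π * gamma0Index N)) * (peterssonProduct (Gamma0 N) k f f).re := by
    rw [integral_mul_const, mul_comm (∫ τ in F, Φr τ), hPet,
      integral_eq_lintegral_of_nonneg_ae (ae_of_all _ hΦr_nonneg) hΦr_cont.aestronglyMeasurable]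
  have hval : ∀ s : ℝ, 1 < s → s ≤ 2 → ∫ τ in F, h s τ = (s - 1) * (2 * ∑' n : ℕ, c n s) := by
    intro s hs1 hs2
    rw [hh]
    dsimp only
    have e1 : ∫ τ in F, Φr τ * ((s - 1) * GN τ s) = (s - 1) * ∫ τ in F, Φr τ * GN τ s := by
      rw [← integral_const_mul]
      congr 1
      funext τ
      ring
    rw [e1]
    congr 1
    rw [integral_eq_lintegral_of_nonneg_ae (ae_of_all _ fun τ ↦ mul_nonneg (hΦr_nonneg τ) (hGN_nonneg τ s))
      (hΦr_cont.measurable.mul (hGN_meas s hs1)).aestronglyMeasurable]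
    have e2 : ∫⁻ τ in F, ENNReal.ofReal (Φr τ * GN τ s) = 2 * ∑' n : ℕ, ENNReal.ofReal (c n s) := by
      rw [← stepA s hs1]
      refine lintegral_congr fun τ ↦ ?_
      rw [ENNReal.ofReal_mul (hΦr_nonneg τ)]
    rw [e2, ENNReal.toReal_mul, ENNReal.tsum_toReal_eq fun n ↦ ENNReal.ofReal_ne_top]
    have e3 : ∑' n : ℕ, (ENNReal.ofReal (c n s)).toReal = ∑' n : ℕ, c n s :=
      tsum_congr fun n ↦ ENNReal.toReal_ofReal (hc_nonneg n s hs1)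
    rw [e3, ENNReal.toReal_ofNat]
  -- conclude
  have hlim2 : Tendsto (fun s : ℝ ↦ (s - 1) * (2 * ∑' n : ℕ, c n s)) (𝓝[>] 1)
      (𝓝 ((6 / (π * gamma0Index N)) * (peterssonProduct (Gamma0 N) k f f).re)) := by
    rw [← hlimval]
    refine hDCT.congr' ?_
    filter_upwards [Ioc_mem_nhdsGT (show (1 : ℝ) < 2 by norm_num)] with s hs
    exact hval s hs.1 hs.2
  have hlim3 := hlim2.mul_const (1 / 2)
  have hval2 : 6 / (π * ↑(gamma0Index N)) * (peterssonProduct (Gamma0 N) k f f).re * (1 / 2) =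
      3 * (peterssonProduct (Gamma0 N) k f f).re / (π * gamma0Index N) := by ring
  rw [hval2] at hlim3
  refine hlim3.congr fun s ↦ ?_
  rw [hc]
  beta_reduce
  ring

/-- **The weight-`k` Petersson norm from the Rankin–Selberg residue**: if
`(s − 1)Σₙ|aₙ|²Γ(s+k−1)(4πn)^{-(s+k−1)} → L` as `s → 1⁺` then `Re(f, f) = π · gamma0Index N · L/3`
(uniqueness of limits with `tendsto_sub_one_mul_tsum_normSq_cuspCoeff_weight`; the weight-`2` case
is `peterssonProduct_re_eq_of_tendsto`). [cite: Bump1997, Thm. 1.6.2 (level 1, weight k); Rankin1939] -/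
theorem peterssonProduct_re_eq_of_tendsto_weight (hk : 0 ≤ k) (f : CuspForm (Gamma0 N) k) {L : ℝ}
    (hL : Tendsto (fun s : ℝ ↦ (s - 1) * ∑' n : ℕ, ‖cuspCoeff f n‖ ^ 2 *
        ((1 / (4 * π * n)) ^ (s + k - 1) * Real.Gamma (s + k - 1))) (𝓝[>] 1) (𝓝 L)) :
    (peterssonProduct (Gamma0 N) k f f).re = π * gamma0Index N * L / 3 := by
  have h := tendsto_nhds_unique (tendsto_sub_one_mul_tsum_normSq_cuspCoeff_weight hk f) hL
  have hπ : (π : ℝ) ≠ 0 := Real.pi_ne_zero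
  have hg : (gamma0Index N : ℝ) ≠ 0 := by exact_mod_cast (gamma0Index_pos N).ne'
  rw [div_eq_iff (mul_ne_zero hπ hg)] at h
  linear_combination h / 3

/-- **Classical form of the weight-`k` residue identity** (`k ≥ 1`):
`(w − k) Σₙ |aₙ|² n^{-w} → (4π)ᵏ/Γ(k) · 3 Re(f,f)/(π [SL₂(ℤ):Γ₀(N)])` as `w → k⁺` (`w = s + k − 1`),
i.e. `Res_{w=k} Σ|aₙ|² n^{-w} = 3 (4π)ᵏ (f,f) / (π (k−1)! [SL₂(ℤ):Γ₀(N)])` for `f ∈ S_k(Γ₀(N))`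
(Rankin 1939; Bump, Thm. 1.6.2 for level `1`: `Res_{s=k} Λ(s, f × f̄) = ½ π^{1−k} ⟨f, f⟩`).
[cite: Bump1997, Thm. 1.6.2 (level 1, weight k); Rankin1939 (Stufe N)] -/
theorem tendsto_sub_weight_mul_tsum_normSq_cuspCoeff_div_rpow (hk : 1 ≤ k) (f : CuspForm (Gamma0 N) k) :
    Tendsto (fun w : ℝ ↦ (w - k) * ∑' n : ℕ, ‖cuspCoeff f n‖ ^ 2 / (n : ℝ) ^ w) (𝓝[>] (k : ℝ))
      (𝓝 (3 * (peterssonProduct (Gamma0 N) k f f).re / (π * gamma0Index N) *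
        ((4 * π) ^ k / Real.Gamma k))) := by
  have hT := tendsto_sub_one_mul_tsum_normSq_cuspCoeff_weight (by omega) f
  have hk0 : (0 : ℝ) < k := by exact_mod_cast hk
  -- substitute `s = w - (k - 1)`
  have hmap : Tendsto (fun w : ℝ ↦ w - ((k : ℝ) - 1)) (𝓝[>] (k : ℝ)) (𝓝[>] 1) := by
    have h := ((continuous_sub_right ((k : ℝ) - 1)).continuousWithinAt (s := Set.Ioi (k : ℝ))
      (x := (k : ℝ))).tendsto_nhdsWithin (t := Set.Ioi (1 : ℝ))
      (fun w hw ↦ by simp only [Set.mem_Ioi] at hw ⊢; linarith)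
    rw [show (k : ℝ) - ((k : ℝ) - 1) = 1 by ring] at h
    exact h
  have h1 := hT.comp hmap
  -- the factor `(4π)^w / Γ(w) → (4π)^k / Γ(k)`
  have hfac : Tendsto (fun w : ℝ ↦ (4 * π) ^ w / Real.Gamma w) (𝓝[>] (k : ℝ))
      (𝓝 ((4 * π) ^ k / Real.Gamma k)) := by
    have hc : ContinuousAt (fun w : ℝ ↦ (4 * π) ^ w / Real.Gamma w) (k : ℝ) := by
      refine ContinuousAt.div ?_ ?_ (Real.Gamma_pos_of_pos hk0).ne'
      · exact (Real.continuousAt_const_rpow (by positivity)).comp continuousAt_id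
      · exact (Real.differentiableAt_Gamma fun m ↦ by
          have : (0 : ℝ) ≤ m := Nat.cast_nonneg m
          linarith).continuousAt
    have hv : (4 * π) ^ (k : ℝ) / Real.Gamma k = (4 * π) ^ k / Real.Gamma k := by
      rw [Real.rpow_intCast]
    rw [← hv]
    exact hc.tendsto.mono_left nhdsWithin_le_nhds
  have h2 := h1.mul hfac
  refine h2.congr' ?_
  filter_upwards [self_mem_nhdsWithin] with w hw
  simp only [Set.mem_Ioi] at hw
  have hw0 : 0 < w := by linarith
  simp only [Function.comp_apply]
  rw [show w - ((k : ℝ) - 1) - 1 = w - k by ring, show w - ((k : ℝ) - 1) + k - 1 = w by ring]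
  -- termwise: `|aₙ|² (1/(4πn))^w Γ(w) · ((4π)^w/Γ(w)) = |aₙ|²/n^w`
  have hΓ : Real.Gamma w ≠ 0 := (Real.Gamma_pos_of_pos hw0).ne'
  have h4π : (0 : ℝ) < 4 * π := by positivity
  rw [mul_assoc, ← tsum_mul_right]
  congr 1
  refine tsum_congr fun n ↦ ?_
  rcases Nat.eq_zero_or_pos n with rfl | hn
  · simp [Real.zero_rpow hw0.ne']
  · have hn' : (0 : ℝ) < n := by exact_mod_cast hn
    rw [one_div, Real.inv_rpow (by positivity), Real.mul_rpow h4π.le hn'.le]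
    field_simp

end ResidueWeight

end Literature.NumberTheory.EllipticCurves.ModularForms

end
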